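/-
Copyright: the b2b-balaban T⁴-continuum CRUX team, row NE7b owner lineage `t4-ne7b-p1` (gen 113). Project licence.
-/
import Summits.QuantumFields.BalabanUV.T4Continuum.Spine.NE7b.OneShotChartSupNorm
import Summits.QuantumFields.BalabanUV.Beta.D1BFx.RJetProjector
import Literature.MathematicalPhysics.QuantumFieldTheory.Balaban1983to89.Beta.EntrywiseVolumeLimit

/-!
# THE ONE-SHOT SECTION IS BLOCK-COVARIANT AND ITS TORUS ROWS ARE BOUNDED BY THE `ℤ⁴` ROW: for the scalar `H = G′Q′*(Q′G′Q′*)⁻¹` of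
# [B5] (1.103) on `ℤ⁴` (block side `m + 1`, `a > 0`): `(Q′G′Q′*)⁻¹(y + t, y′ + t) = (Q′G′Q′*)⁻¹(y, y′)` and
# `H(p + (m+1)t, y + t) = H(p, y)` for every `t ∈ ℤ⁴`; and for every coarse torus period `s` the PERIODISED rows
# `Ĥ(p, c) := Σ_n H(p, ĉ + s·n)` satisfy `Σ_{c ∈ (ℤ∕s)⁴} |Ĥ(p, c)| ≤ Σ′_y |H(p, y)| ≤ C_∞(4,a)`, independently of the representatives —
# (CT-4), the torus lift of (46)'s sup letter (row NE7b, node U5c; NL-NE7b-1′ limb 1a's located residue, PRICING-NE7b v122 F726 (c);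
# `RJetProjector.gq_translate`, `B4Sect5Exhaustion.eq_limInv_of_right_inverse`, `Beta.VolumeConvolution.tsum_eq_sum_tsum_imageShift` BY NAME; [folklore])

Cell `pub-balaban`, sub-cell `t4`, spine estimate NE7b (`T4WeightBudget.RelWeightBound`; the cell's OWN estimate — NOT PRINTED
in [Bałaban 1983–89], NOT PROVED).  Crux-route work under `Spine/NE7b/` by the row OWNER (`t4-ne7b-p1` gen 113) under FREEZE
(0)'s crux-prover clause (RULING W-ne7bp1-g113-1, FILING-CLAIM C-ne7bp1-g113-9); NOTHING of Bałaban's is asserted; no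
`T4Continuum/Support` leaf typed; no `def` (the periodised row is written out as the image series); zero `sorry`.  d = 4 throughout, because
the tree's block-translation lemmas (`GhostLeg.Gk_translate`, `RJetProjector.gq_translate` ∕ `mem_B_add_iff`) are typed on `ℤ⁴`.
Imports (BY NAME): (46) `OneShotChartSupNorm` (`summable_abs_kerH_row`, `tsum_abs_kerH_le_sup`), the β-team's `D1BFx/RJetProjector`
(`gq_translate`, `mem_B_add_iff`), the Literature periodisation kit `Beta/EntrywiseVolumeLimit` ⊇ `Beta/VolumeConvolution` (`tsum_eq_sum_tsum_imageShift`,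
`imageShift`, `imageShift_injective`, `windowMap`), and through them `B5Hk103ScalarZd` (`kerH`, `gq`, `Kinv`, `toK`, `summable_kerH`, `abs_Kinv_le`),
`B6QGQLower276` ∕ `B6QGQDecay237` (`kerQGQ`, `KerQGQ`, `hyp56Z_KerQGQ_unif`, `gammaQ`, `cU`, `deltaU`, `cInv`), `B4Sect5Exhaustion`
(`eq_limInv_of_right_inverse`, `tsum_mul_limInv`).

WHY (located).  HRS reads the radius letter on `Fintype` carriers (a torus); (46) typed `‖H_M‖_{∞→∞} ≤ C_∞` on `ℤ^d`.  T-109 (CT-4): «the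
torus section's kernel is the periodisation (images) of the `ℤ^d` kernel, and `‖periodised row‖_{ℓ¹} ≤ ‖row‖_{ℓ¹(ℤ^d)}` — one line».  The
one line is `Beta.tsum_eq_sum_tsum_imageShift` (the β-team's method-of-images kit); what makes the periodised matrix an honest torus object
(independent of the window representatives) is the BLOCK COVARIANCE of `H`, which needs the translation invariance of the unit-lattice inverse
`(Q′G′Q′*)⁻¹` — the uniqueness-of-the-bounded-inverse argument the β-team ran for `G′` (`Gk_translate`) and for «the operator C»
(`Csq_translate`), run here for `Kinv`.  The identification of the periodised kernel with a torus-side constrained minimiser is NOT here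
(no scalar torus section object in the tree; (A3)).

WHAT IS PROVED ([folklore]; d = 4, `m : ℕ`, `a > 0`):
* §1 `kerQGQ_translate`, `tsum_kerQGQ_mul_Kinv` (`(Q′G′Q′*)(Q′G′Q′*)⁻¹ = 1` entrywise, series over the middle index), **`Kinv_translate`**,
  **`kerH_translate`** (`kerH m a (p + side m • t) (y + t) = kerH m a p y`).
* §2 `summable_kerH_images`, `summable_abs_kerH_images`, **`sum_abs_tsum_kerH_images_le`** (`Σ_{c : Site 4 s} |Σ′_n H(p, imageShift s ĉ n)| ≤
  Σ′_y |H(p,y)|`), **`sum_abs_tsum_kerH_images_le_sup`** (`≤ cHs 4 a · K_4(δ_H)` = (46)'s `C_∞`, every side, every torus period `s`),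
  `tsum_kerH_images_coarse_shift` (the image series does not change under `w ↦ w + s·t′`), **`tsum_kerH_images_fine_shift`** (nor under
  `p ↦ p + side m • (s • t)`: representative independence in the fine variable — block covariance).
* §3 toy.

HONEST (what this is NOT).  d = 4 only; constants existential (as (46)); the periodised kernel is NOT identified with a torus minimiser; nothing of
the covariant `H_k` ((A3), NC-NE7b-α UNRULED).  BY-NAME EFFECT ON THE WALL: NONE.  NE7b NOT PRINTED ∕ NOT PROVED; spine PROVED 0∕9; rung (B)+1
on a FINITE torus — NOT infinite volume, NOT the mass gap, NOT Clay.  HONEST DEPENDENCY: continuum YM on T⁴ ⇐ BetaPertH ∧ nine spine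
estimates (0∕9 proved); BetaPertH ⇐ (D1) ∧ (D4) ∧ CAP+tail; G-an2-4 gates asym, D1 and NE2∕3∕4.
-/

set_option autoImplicit false

namespace Summit.QuantumFields.BalabanUV.T4Continuum.NE7b.OneShotChartTorusRows

open Finset Real
open Literature.MathematicalPhysics.QuantumFieldTheory.Balaban1983to89
open B4Sect5Exhaustion (limInv eq_limInv_of_right_inverse tsum_mul_limInv)
open B4Sect5Proof (latticeConst latticeConst_nonneg)
open B6QGQLower276 (X blk B mem_B side kerQGQ KerQGQ gammaQ gammaQ_pos)
open B6QGQDecay237 (cU cU_pos deltaU deltaU_pos cInv cInv_pos deltaInv deltaInv_pos hyp56Z_KerQGQ_unif)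
open B5Hk103ScalarZd (kerH gq Kinv toK summable_kerH abs_Kinv_le deltaH deltaH_pos)
open Summit.QuantumFields.BalabanUV.Beta.D1BFx.BlockColumnSupNorm (cHs)
open Summit.QuantumFields.BalabanUV.Beta.D1BFx.RJetProjector (gq_translate mem_B_add_iff)
open OneShotChartSupNorm (summable_abs_kerH_row tsum_abs_kerH_le_sup)

noncomputable section

variable {a : ℝ}

/-! ## §1. Block covariance of the one-shot section on `ℤ⁴` -/

/-- `Q′G′Q′*` is translation-invariant on the unit lattice: `kerQGQ m a (y + t) (y′ + t) = kerQGQ m a y y′`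
(block reindexing `B(y + t) = B(y) + side·t` and `gq_translate`). [folklore] -/
theorem kerQGQ_translate (m : ℕ) (ha : 0 < a) (t y y' : X 4) : kerQGQ m a (y + t) (y' + t) = kerQGQ m a y y' := by
  have hL : ∀ z z' : X 4, kerQGQ m a z z' = (((m : ℝ) + 1) ^ 4)⁻¹ * ∑ p ∈ B m z, gq m a p z' := fun z z' => rfl
  rw [hL, hL]
  congr 1
  have hinj : Set.InjOn (fun q : X 4 => q + side m • t) ↑(B m y) := fun q _ q' _ h => add_right_cancel h
  have himg : B m (y + t) = (B m y).image (fun q : X 4 => q + side m • t) := by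
    ext q
    rw [Finset.mem_image, mem_B_add_iff]
    constructor
    · intro h; exact ⟨q - side m • t, h, sub_add_cancel q _⟩
    · rintro ⟨q', hq', rfl⟩; rwa [add_sub_cancel_right]
  rw [himg, Finset.sum_image hinj]
  exact Finset.sum_congr rfl fun p _ => gq_translate m ha t p y'

/-- `(Q′G′Q′*)·(Q′G′Q′*)⁻¹ = 1` entrywise with the series over the middle index (`B4Sect5Exhaustion.tsum_mul_limInv`). [folklore] -/
theorem tsum_kerQGQ_mul_Kinv (m : ℕ) (ha : 0 < a) (y y' : X 4) :
    ∑' w : X 4, kerQGQ m a y w * Kinv m a w y' = if y = y' then 1 else 0 := by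
  have h2 : ∀ w : X 4, kerQGQ m a y w * Kinv m a w y'
      = KerQGQ m a (toK y) (toK w) * limInv Set.univ (KerQGQ m a) (toK w) (toK y') := fun w => rfl
  simp_rw [h2]
  rw [Equiv.tsum_eq (toK (d := 4)) (fun q' => KerQGQ m a (toK y) q' * limInv Set.univ (KerQGQ m a) q' (toK y'))]
  rw [tsum_mul_limInv (gammaQ_pos 4 ha) (cU_pos 4 ha) (deltaU_pos 4 ha) (hyp56Z_KerQGQ_unif m ha)
    (Set.mem_univ _) (Set.mem_univ _)]
  simp [toK, Prod.ext_iff]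

/-- **`(Q′G′Q′*)⁻¹` IS TRANSLATION-INVARIANT**: `Kinv m a (y + t) (y′ + t) = Kinv m a y y′` — the translated kernel is again a bounded right
inverse of the translation-invariant `Q′G′Q′*`, and the bounded inverse on `ℤ⁴` is unique (`eq_limInv_of_right_inverse`; the pattern of
`GhostLeg.Gk_translate` ∕ `RJetProjector.Csq_translate`). [folklore] -/
theorem Kinv_translate (m : ℕ) (ha : 0 < a) (t y y' : X 4) : Kinv m a (y + t) (y' + t) = Kinv m a y y' := by
  have hγ := gammaQ_pos 4 ha
  have hbd : ∀ p' q' : B4Sect5Exhaustion.K 4 1, |Kinv m a (p'.1 + t) (q'.1 + t)| ≤ cInv 4 a := fun p' q' => by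
    refine (abs_Kinv_le m ha _ _).trans (mul_le_of_le_one_right (cInv_pos 4 ha).le ?_)
    rw [Real.exp_le_one_iff, neg_nonpos]
    have := deltaInv_pos 4 ha
    positivity
  have hinv : ∀ p' r' : B4Sect5Exhaustion.K 4 1, p'.1 ∈ (Set.univ : Set (X 4)) → r'.1 ∈ (Set.univ : Set (X 4)) →
      ∑' q' : B4Sect5Exhaustion.K 4 1, KerQGQ m a p' q' * Kinv m a (q'.1 + t) (r'.1 + t) = if p' = r' then 1 else 0 := by
    intro p' r' _ _
    have h1 : ∑' q' : B4Sect5Exhaustion.K 4 1, KerQGQ m a p' q' * Kinv m a (q'.1 + t) (r'.1 + t)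
        = ∑' w : X 4, kerQGQ m a p'.1 w * Kinv m a (w + t) (r'.1 + t) := by
      rw [← Equiv.tsum_eq (toK (d := 4))]
      rfl
    have h2 : ∀ w : X 4, kerQGQ m a p'.1 w * Kinv m a (w + t) (r'.1 + t)
        = kerQGQ m a (p'.1 + t) (w + t) * Kinv m a (w + t) (r'.1 + t) := fun w => by rw [kerQGQ_translate m ha]
    have h3 : ∑' w : X 4, kerQGQ m a (p'.1 + t) (w + t) * Kinv m a (w + t) (r'.1 + t)
        = ∑' w' : X 4, kerQGQ m a (p'.1 + t) w' * Kinv m a w' (r'.1 + t) :=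
      (Equiv.addRight t).tsum_eq (fun w' => kerQGQ m a (p'.1 + t) w' * Kinv m a w' (r'.1 + t))
    rw [h1, tsum_congr h2, h3, tsum_kerQGQ_mul_Kinv m ha]
    have hiff : p'.1 + t = r'.1 + t ↔ p' = r' := by
      rw [add_left_inj]
      exact ⟨fun h => Prod.ext h (Subsingleton.elim _ _), fun h => by rw [h]⟩
    simp only [hiff]
  exact eq_limInv_of_right_inverse hγ (cU_pos 4 ha) (deltaU_pos 4 ha) (hyp56Z_KerQGQ_unif (d := 4) m ha)
    (D := fun p' q' : B4Sect5Exhaustion.K 4 1 => Kinv m a (p'.1 + t) (q'.1 + t)) (M := cInv 4 a) hbd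
    (fun p' q' h => absurd (Set.mem_univ _) h) hinv (p := (y, 0)) (s := (y', 0)) (Set.mem_univ _) (Set.mem_univ _)

/-- **THE ONE-SHOT SECTION IS BLOCK-COVARIANT**: `kerH m a (p + side m • t) (y + t) = kerH m a p y` for every `t ∈ ℤ⁴`. [folklore] -/
theorem kerH_translate (m : ℕ) (ha : 0 < a) (t p y : X 4) : kerH m a (p + side m • t) (y + t) = kerH m a p y := by
  unfold kerH
  rw [← (Equiv.addRight t).tsum_eq (fun w => gq m a (p + side m • t) w * Kinv m a w (y + t))]
  exact tsum_congr fun w => by simp only [Equiv.coe_addRight, gq_translate m ha, Kinv_translate m ha]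

/-! ## §2. The periodised rows on the coarse torus `(ℤ∕s)⁴` -/

/-- The image series of a row converges. [folklore] -/
theorem summable_kerH_images (m : ℕ) (ha : 0 < a) (s : ℕ) [NeZero s] (p w : X 4) :
    Summable fun n : X 4 => kerH m a p (Beta.imageShift s w n) :=
  (summable_abs_kerH_row m ha p).of_abs.comp_injective (Beta.imageShift_injective s w)

/-- … absolutely. [folklore] -/
theorem summable_abs_kerH_images (m : ℕ) (ha : 0 < a) (s : ℕ) [NeZero s] (p w : X 4) :
    Summable fun n : X 4 => |kerH m a p (Beta.imageShift s w n)| :=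
  (summable_abs_kerH_row m ha p).comp_injective (Beta.imageShift_injective s w)

/-- **THE TORUS ROWS ARE BOUNDED BY THE `ℤ⁴` ROW**: for every coarse period `s`, every fine site `p`,
`Σ_{c : (ℤ∕s)⁴} |Σ′_n H(p, imageShift s ĉ n)| ≤ Σ′_y |H(p, y)|` (method of images: `Beta.tsum_eq_sum_tsum_imageShift`). [folklore] -/
theorem sum_abs_tsum_kerH_images_le (m : ℕ) (ha : 0 < a) (s : ℕ) [NeZero s] (p : X 4) :
    ∑ c : Beta.Site 4 s, |∑' n : X 4, kerH m a p (Beta.imageShift s (Beta.windowMap 4 s c) n)|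
      ≤ ∑' y : X 4, |kerH m a p y| := by
  rw [Beta.tsum_eq_sum_tsum_imageShift (s := s) (summable_abs_kerH_row m ha p)]
  refine Finset.sum_le_sum fun c _ => ?_
  have hs : Summable fun n : X 4 => ‖kerH m a p (Beta.imageShift s (Beta.windowMap 4 s c) n)‖ := by
    simpa only [Real.norm_eq_abs] using summable_abs_kerH_images m ha s p (Beta.windowMap 4 s c)
  have h := norm_tsum_le_tsum_norm hs
  simpa only [Real.norm_eq_abs] using h

/-- **THE TORUS LIFT OF (46)'s SUP LETTER**: `Σ_{c : (ℤ∕s)⁴} |Σ′_n H(p, imageShift s ĉ n)| ≤ cHs(4,a)·K_4(δ_H)` for every side `m + 1`, every coarse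
period `s`, every fine site `p` — the periodised one-shot kernel has torus row sums `≤ C_∞(4,a)`. [folklore] -/
theorem sum_abs_tsum_kerH_images_le_sup (m : ℕ) (ha : 0 < a) (s : ℕ) [NeZero s] (p : X 4) :
    ∑ c : Beta.Site 4 s, |∑' n : X 4, kerH m a p (Beta.imageShift s (Beta.windowMap 4 s c) n)|
      ≤ cHs 4 a * latticeConst 4 (deltaH 4 a) :=
  (sum_abs_tsum_kerH_images_le m ha s p).trans (tsum_abs_kerH_le_sup (by norm_num) m ha p)

/-- The image series does not depend on the coarse representative: `w ↦ w + s·t′` permutes the images. [folklore] -/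
theorem tsum_kerH_images_coarse_shift (m : ℕ) (a : ℝ) (s : ℕ) (p w t' : X 4) :
    ∑' n : X 4, kerH m a p (Beta.imageShift s (Beta.imageShift s w t') n) = ∑' n : X 4, kerH m a p (Beta.imageShift s w n) := by
  simp_rw [Beta.imageShift_add]
  exact (Equiv.addLeft t').tsum_eq (fun n => kerH m a p (Beta.imageShift s w n))

/-- **REPRESENTATIVE INDEPENDENCE IN THE FINE VARIABLE** (block covariance): shifting the fine site by a full fine-torus period,
`p ↦ p + side m • (s • t)`, leaves every periodised row entry unchanged. [folklore] -/
theorem tsum_kerH_images_fine_shift (m : ℕ) (ha : 0 < a) (s : ℕ) (p w t : X 4) :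
    ∑' n : X 4, kerH m a (p + side m • ((s : ℤ) • t)) (Beta.imageShift s w n) = ∑' n : X 4, kerH m a p (Beta.imageShift s w n) := by
  have hre : ∀ n : X 4, Beta.imageShift s w n = Beta.imageShift s w (n - t) + (s : ℤ) • t := by
    intro n; funext i
    simp only [Beta.imageShift_apply, Pi.add_apply, Pi.sub_apply, Pi.smul_apply, smul_eq_mul]
    ring
  calc ∑' n : X 4, kerH m a (p + side m • ((s : ℤ) • t)) (Beta.imageShift s w n)
      = ∑' n : X 4, kerH m a p (Beta.imageShift s w (n - t)) := by
        refine tsum_congr fun n => ?_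
        rw [hre n, kerH_translate m ha]
    _ = ∑' n : X 4, kerH m a p (Beta.imageShift s w n) :=
        (Equiv.subRight t).tsum_eq (fun n => kerH m a p (Beta.imageShift s w n))

/-! ## §3. Toy -/

/-- Toy: the image re-indexing used in §2 — `w + s(n) = (w + s(n − t)) + s·t` in one coordinate (`s = 5`, `w = 2`, `n = 7`, `t = 3`). -/
example : (2 : ℤ) + 5 * 7 = (2 + 5 * (7 - 3)) + 5 * 3 := by norm_num

end

end Summit.QuantumFields.BalabanUV.T4Continuum.NE7b.OneShotChartTorusRows
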